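import Summits.ABC.ABC.Theses.IsogenyGlueCongruence
import Summits.ABC.ABC.Theorems.IsogenyGlueCongruenceModularDatumExists
import Summits.ABC.ABC.Theorems.IsogenyGlueCongruenceDegreePrimeCongruenceOfFacts
import Summits.ABC.ABC.Theorems.IsogenyGlueCongruenceSemistableHeightPolyBoundSemistableSlice
import Literature.NumberTheory.Automorphic.CDTTheorem712ConductorStepProofs
import Literature.NumberTheory.EllipticCurves.LFunctionSmulProofs
import Literature.NumberTheory.EllipticCurves.SzpiroOfAbcProofs
import Literature.NumberTheory.EllipticCurves.GlobalMinimalModelProofs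
import Literature.NumberTheory.DiophantineGeometry.LocalReductionProofs
import HarnessLib

/-!
# Route IsogenyGlueCongruence, item `SemistableModularDatum` (stmt-ABC-15180): the item is
# exactly the modularity of semistable elliptic curves over `ℚ` (Wiles 1995, Thm. 0.4)

Item stmt-ABC-15180 of route `IsogenyGlueCongruence` (support, rank 9; a hypothesis of the
route's lines, not a crux) has the signature

  `∀ (W : WeierstrassCurve ℚ) [W.IsElliptic] [W.IsGloballyMinimal] [NeZero (W.conductorNorm ℤ)],
     W.IsSemistable ℤ → Nonempty (ModularParametrizationData W (W.conductorNorm ℤ))`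

— every SEMISTABLE elliptic curve over `ℚ`, in a globally minimal model `W` of conductor `N_W`,
carries a modular parametrisation datum at level `N_W` (newform `f` with `aₙ(f) = aₙ(W)`, Néron
period pair and uniformisation, an integer Manin constant `c` with `c Λ_f ⊆ Λ_W`, the degree).
It is the semistable slice of the sibling item `ModularDatumExists` (stmt-ABC-15126, which is
definitionally the named fact `nonempty_modularParametrizationData` and unconditionally
equivalent to BCDT 2001 Thm. A, `modularDatumExists_iff_exists_isNewformOf`), and it is the
whole modularity input of the route's K-line (`DegreePrimeCongruence`), U-line
(`ModularJacobianMultipliers`, `SemistableHeightPolyBound`) and A-line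
(`DegreePrimesPolyBounded.stub_discValuationOfSemistableModularity`).

Every theorem below states the item's signature VERBATIM (the route decl
`Summit.ABC.ABC.Theses.IsogenyGlueCongruence.SemistableModularDatum` is, by the gate's
construction, definitionally this statement, so each theorem applies to it by `exact`).

* `semistableModularDatum_iff_forall_isModular` — **unconditionally, the item is equivalent to
  "every semistable elliptic curve over `ℚ` given by a globally minimal model is modular"**
  (`BCDT.IsModular W`: a newform `f ∈ S₂(Γ₀(N_W))` with `aₙ(f) = aₙ(W)`), by the tree's
  per-curve theorem `nonempty_modularParametrizationData_iff_isModular` (Néron lattice, rational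
  Manin constant `IsNewformOf.exists_maninConstant_ne_zero_holds`, uniformisation and degree are
  all PROVED).
* `semistableModularDatum_iff_wiles` — **the model condition is idle**: the item is equivalent
  to Wiles' Theorem 0.4 as printed, "every semistable elliptic curve over `ℚ` is modular", for
  ANY Weierstrass model (global minimal models exist over `ℚ`, `hasGlobalMinimalModel_rat_holds`;
  semistability, the conductor and the `aₙ` are isomorphism invariants —
  `isSemistable_smul_iff_holds`, `conductorNorm_smul_rat`, `LFunction_smul`, all proved; so is
  modularity, `isModular_smul_iff`).  This is the EXACT RESIDUAL of the item: nothing else is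
  left, and nothing less suffices.
* Closed forms modulo ONE named fact each: `semistableModularDatum_of_CDT_theorem_7_1_2`
  (Conrad–Diamond–Taylor 1999, Thm. 7.1.2: `27 ∤ N_E ⟹ E` modular — the smallest catalogued
  fact containing Wiles' theorem; a semistable curve has squarefree conductor), hence from the
  four printed inputs of that theorem (`…_of_CDT721_722_723_switch`, `…_auxiliaryCurve`: CDT
  Thm. 7.2.1, Thm. 7.2.2, Lemma 7.2.3 and the `3`–`5` switch / the Shepherd-Barron–Taylor
  auxiliary curve; glue PROVED in the tree); `semistableModularDatum_of_exists_isNewformOf`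
  (BCDT Thm. A); `semistableModularDatum_of_modularDatumExists` (the sibling route item).
* Where the item sits: granted the Mazur–Kenku comparison (route item `MazurKenkuBound`) it is
  EQUIVALENT to the K-line fact `DegreePrimeCongruence`
  (`degreePrimeCongruence_iff_semistableModularDatum`), gives the height bound
  `SemistableHeightPolyBound` and the A-line valuation bound `v_p(Δ_min) ≤ C · N^κ`
  (`discValuation_of_mazurKenkuBound_of_semistableModularDatum`); granted the modular Jacobian
  with multiplicity one it is EQUIVALENT to the U-line fact `ModularJacobianMultipliers` (the
  tree's `modularJacobianMultipliers_iff_modularDatumExists_semistable`, not restated); and each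
  of those two facts implies it outright.

So the item closes by `exact semistableModularDatum_of_CDT_theorem_7_1_2 h` the day
`BCDT.CDT_theorem_7_1_2` is discharged (or from `exists_isNewformOf`, or together with
stmt-ABC-15126).  No unconditional proof is possible in the tree: by
`semistableModularDatum_iff_wiles` it would be a proof of Wiles' theorem, every road to which
ends in catalogued `R = T` / Langlands–Tunnell / `3`–`5`-switch named facts
(`Cruxes/ModularDatumExists/NOTES.md`; `Cruxes/FreyModularity/Lines/Sketch.lean`).  No new
definition; no named fact is introduced or discharged.

## References

* [Wiles1995] A. Wiles, *Modular elliptic curves and Fermat's Last Theorem*, Ann. of Math. 141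
  (1995), 443–551: Thm. 0.4 ("Suppose that `E` is a semistable elliptic curve defined over
  `ℚ`. Then `E` is modular.").
* [TaylorWiles1995] R. Taylor, A. Wiles, *Ring-theoretic properties of certain Hecke algebras*,
  Ann. of Math. 141 (1995), 553–572.
* [ConradDiamondTaylor1999] B. Conrad, F. Diamond, R. Taylor, *Modularity of certain
  potentially Barsotti–Tate Galois representations*, J. Amer. Math. Soc. 12 (1999), 521–567:
  Thm. 7.1.2 (p. 551) and its proof (p. 556); Thm. 7.2.1, Thm. 7.2.2, Lemma 7.2.3.
* [BCDTJAMS2001] C. Breuil, B. Conrad, F. Diamond, R. Taylor, *On the modularity of elliptic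
  curves over `ℚ`: wild 3-adic exercises*, J. Amer. Math. Soc. 14 (2001), 843–939: Thm. A;
  p. 845, (2) ⇔ (6).
* [SilvermanAEC2009] J. H. Silverman, *The Arithmetic of Elliptic Curves*, 2nd ed., GTM 106:
  VII.5 Prop. 5.1, VIII.8 Cor. 8.3, App. C §16.
* [PastenShimura2024] H. Pasten, *Shimura curves and the abc conjecture*, J. Number Theory 254
  (2024), 214–335: §3 p. 13.
-/

-- `Summit.<Summit>.<Problem>` is the mandated summit-side namespace (CONVENTIONS §2); for the
-- single-conjunct summit `ABC` the two coincide, so the duplicate `ABC.ABC` is deliberate.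
set_option linter.dupNamespace false

noncomputable section

open scoped MatrixGroups ModularForm

open CongruenceSubgroup
open Literature.NumberTheory.EllipticCurves
open Literature.NumberTheory.EllipticCurves.ModularForms
open Literature.NumberTheory.Automorphic

namespace Summit.ABC.ABC.Theorems

/-! ### The item is semistable modularity, unconditionally -/

/-- **`SemistableModularDatum` ↔ every semistable elliptic curve over `ℚ` in a globally minimal
model is modular**, unconditionally.  The item (a `ModularParametrizationData W N_W` for every
semistable globally minimal elliptic `W/ℚ`) holds iff `BCDT.IsModular W` — a newform
`f ∈ S₂(Γ₀(N_W))` with `aₙ(f) = aₙ(W)` for all `n`, condition (2) of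
Breuil–Conrad–Diamond–Taylor 2001, p. 845 — for every such `W`: per curve this is the tree's
`nonempty_modularParametrizationData_iff_isModular` ((2) ⇔ (6): the datum's own newform one
way; the other way a Néron-type period pair, the rational Manin constant
`IsNewformOf.exists_maninConstant_ne_zero_holds` — Shimura's construction and Faltings —,
uniformisation and degree, all proved).  For semistable curves (2) is Wiles 1995, Thm. 0.4.
[cite: Wiles1995, Thm. 0.4] [cite: BCDTJAMS2001, p. 845, (2) ⇔ (6)] -/
theorem semistableModularDatum_iff_forall_isModular :
    (∀ (W : WeierstrassCurve ℚ) [W.IsElliptic] [W.IsGloballyMinimal]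
        [NeZero (W.conductorNorm ℤ)],
        W.IsSemistable ℤ → Nonempty (ModularParametrizationData W (W.conductorNorm ℤ))) ↔
      ∀ (W : WeierstrassCurve ℚ) [W.IsElliptic] [W.IsGloballyMinimal]
        [NeZero (W.conductorNorm ℤ)], W.IsSemistable ℤ → BCDT.IsModular W :=
  forall_congr' fun W ↦ forall_congr' fun _ ↦ forall_congr' fun _ ↦ forall_congr' fun _ ↦
    forall_congr' fun _ ↦ nonempty_modularParametrizationData_iff_isModular W

/-- **The item yields modularity of every semistable globally minimal elliptic `W/ℚ`** (the `→`
half of `semistableModularDatum_iff_forall_isModular`, curried for consumers): the datum's own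
newform. [cite: Wiles1995, Thm. 0.4] -/
theorem isModular_of_semistableModularDatum
    (h : ∀ (W : WeierstrassCurve ℚ) [W.IsElliptic] [W.IsGloballyMinimal]
      [NeZero (W.conductorNorm ℤ)],
      W.IsSemistable ℤ → Nonempty (ModularParametrizationData W (W.conductorNorm ℤ)))
    (W : WeierstrassCurve ℚ) [W.IsElliptic] [W.IsGloballyMinimal] [NeZero (W.conductorNorm ℤ)]
    (hW : W.IsSemistable ℤ) : BCDT.IsModular W :=
  semistableModularDatum_iff_forall_isModular.mp h W hW

/-! ### The model condition is idle: Wiles' form -/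

/-- `BCDT.IsModular W` read at any level `N` equal to the conductor `N_W`: a newform of `W` in
`S₂(Γ₀(N))` (transport of the level type along `N_W = N`, by `subst`). [folklore] -/
theorem isModular_iff_exists_isNewformOf_of_eq (W : WeierstrassCurve ℚ)
    [NeZero (W.conductorNorm ℤ)] {N : ℕ} [NeZero N] (h : W.conductorNorm ℤ = N) :
    BCDT.IsModular W ↔ ∃ f : CuspForm (Gamma0 N) 2, IsNewformOf W f := by
  subst h
  rfl

/-- **Modularity is a property of the elliptic curve, not of the Weierstrass model**: for an
admissible change of variables `C`, `C • W` is modular iff `W` is.  The conductor is an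
isomorphism invariant (`conductorNorm_smul_rat`, Silverman AEC App. C §16 / ATAEC IV.10) and so
are the coefficients `aₙ` of Mathlib's `WeierstrassCurve.LFunction` (`LFunction_smul`), hence
`IsNewformOf (C • W) f ↔ IsNewformOf W f` for every `f` of level `N_W = N_{C • W}`.
[cite: SilvermanAEC2009, App. C §16] -/
theorem isModular_smul_iff (W : WeierstrassCurve ℚ) [W.IsElliptic]
    (C : WeierstrassCurve.VariableChange ℚ) [NeZero (W.conductorNorm ℤ)]
    [NeZero ((C • W).conductorNorm ℤ)] : BCDT.IsModular (C • W) ↔ BCDT.IsModular W := by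
  rw [isModular_iff_exists_isNewformOf_of_eq (C • W) (W.conductorNorm_smul_rat C)]
  refine exists_congr fun f ↦ ?_
  simp only [IsNewformOf, WeierstrassCurve.LFunction_smul]

/-- **The exact residual: `SemistableModularDatum` ↔ Wiles' Theorem 0.4 as printed** — "every
semistable elliptic curve over `ℚ` is modular", for ANY Weierstrass model `W/ℚ` (elliptic,
`N_W ≥ 1`, semistable), with no global-minimality condition.  (←) specialise.  (→) an elliptic
`W/ℚ` has a global minimal model `C • W` (`hasGlobalMinimalModel_rat_holds`, Silverman AEC
VIII.8 Cor. 8.3, PROVED); `C • W` is semistable iff `W` is (`isSemistable_smul_iff_holds`, AEC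
VII.5 Prop. 5.1, PROVED) and has the same conductor (`conductorNorm_smul_rat`); the item makes
`C • W` modular (`semistableModularDatum_iff_forall_isModular`) and modularity descends to `W`
(`isModular_smul_iff`).  So an unconditional proof of the item would be a proof of Wiles'
theorem, and conversely. [cite: Wiles1995, Thm. 0.4] [cite: SilvermanAEC2009, VIII.8 Cor. 8.3] -/
theorem semistableModularDatum_iff_wiles :
    (∀ (W : WeierstrassCurve ℚ) [W.IsElliptic] [W.IsGloballyMinimal]
        [NeZero (W.conductorNorm ℤ)],
        W.IsSemistable ℤ → Nonempty (ModularParametrizationData W (W.conductorNorm ℤ))) ↔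
      ∀ (W : WeierstrassCurve ℚ) [W.IsElliptic] [NeZero (W.conductorNorm ℤ)],
        W.IsSemistable ℤ → BCDT.IsModular W := by
  rw [semistableModularDatum_iff_forall_isModular]
  refine ⟨fun h W _ _ hW ↦ ?_, fun h W _ _ _ hW ↦ h W hW⟩
  obtain ⟨C, hC⟩ := WeierstrassCurve.hasGlobalMinimalModel_rat_holds W
  haveI : NeZero ((C • W).conductorNorm ℤ) := by rw [W.conductorNorm_smul_rat C]; infer_instance
  exact (isModular_smul_iff W C).mp
    (h (C • W) ((WeierstrassCurve.isSemistable_smul_iff_holds ℤ W C).mpr hW))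

/-! ### Closed forms modulo one named fact -/

/-- **`SemistableModularDatum` from Conrad–Diamond–Taylor 1999, Thm. 7.1.2 alone** (the named
fact `BCDT.CDT_theorem_7_1_2`: an elliptic curve over `ℚ` whose conductor is not divisible by
`27` is modular; it contains Wiles 1995 Thm. 0.4 / Taylor–Wiles, the semistable case): a
semistable curve has squarefree conductor (`isSemistable_iff_squarefree_conductorNorm`), so
`27 ∤ N_W`, and the tree's
`nonempty_modularParametrizationData_of_isSemistable_of_CDT_theorem_7_1_2` gives the datum.
This is the one-hypothesis form in which item stmt-ABC-15180 closes the day the fact is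
discharged.  CONDITIONAL on `BCDT.CDT_theorem_7_1_2`.
[cite: ConradDiamondTaylor1999, Thm. 7.1.2] -/
theorem semistableModularDatum_of_CDT_theorem_7_1_2 (h712 : BCDT.CDT_theorem_7_1_2) :
    ∀ (W : WeierstrassCurve ℚ) [W.IsElliptic] [W.IsGloballyMinimal]
      [NeZero (W.conductorNorm ℤ)],
      W.IsSemistable ℤ → Nonempty (ModularParametrizationData W (W.conductorNorm ℤ)) :=
  fun W _ _ _ hW ↦
    nonempty_modularParametrizationData_of_isSemistable_of_CDT_theorem_7_1_2 h712 W hW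

/-- **`SemistableModularDatum` from exactly the four printed inputs of CDT Thm. 7.1.2** —
Thm. 7.2.1 (Langlands–Tunnell + lifting at `3`), Thm. 7.2.2 (lifting at `5`), Lemma 7.2.3
(Elkies' sporadic `j`-invariants) and the `3`–`5` switch —, through the tree's PROVED glue
`BCDT.CDT_theorem_7_1_2_of_CDT721_722_723_switch` (proof of Thm. 7.1.2, p. 556, with the
conductor step and Ogg's formula at `3` discharged) and
`semistableModularDatum_of_CDT_theorem_7_1_2`.  CONDITIONAL on the four named facts.
[cite: ConradDiamondTaylor1999, Thm. 7.1.2 (proof, p. 556)] -/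
theorem semistableModularDatum_of_CDT721_722_723_switch (h721 : BCDT.CDT_theorem_7_2_1)
    (h722 : BCDT.CDT_theorem_7_2_2) (h723 : BCDT.CDT_lemma_7_2_3_isModular)
    (hsw : BCDT.CDT_three_five_switch) :
    ∀ (W : WeierstrassCurve ℚ) [W.IsElliptic] [W.IsGloballyMinimal]
      [NeZero (W.conductorNorm ℤ)],
      W.IsSemistable ℤ → Nonempty (ModularParametrizationData W (W.conductorNorm ℤ)) :=
  semistableModularDatum_of_CDT_theorem_7_1_2
    (BCDT.CDT_theorem_7_1_2_of_CDT721_722_723_switch h721 h722 h723 hsw)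

/-- **`SemistableModularDatum` from CDT Thm. 7.2.1, Thm. 7.2.2, Lemma 7.2.3 and the
Shepherd-Barron–Taylor auxiliary curve**
(`BCDT.exists_isTorsionGaloisRep_five_and_surjective_three`, which implies the `3`–`5` switch;
glue `BCDT.CDT_theorem_7_1_2_of_CDT721_722_723_auxiliaryCurve`, PROVED).  CONDITIONAL on the
four named facts. [cite: ConradDiamondTaylor1999, Thm. 7.1.2 (proof, p. 556)]
[cite: BCDTJAMS2001, §2.2] -/
theorem semistableModularDatum_of_CDT721_722_723_auxiliaryCurve (h721 : BCDT.CDT_theorem_7_2_1)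
    (h722 : BCDT.CDT_theorem_7_2_2) (h723 : BCDT.CDT_lemma_7_2_3_isModular)
    (hE : BCDT.exists_isTorsionGaloisRep_five_and_surjective_three) :
    ∀ (W : WeierstrassCurve ℚ) [W.IsElliptic] [W.IsGloballyMinimal]
      [NeZero (W.conductorNorm ℤ)],
      W.IsSemistable ℤ → Nonempty (ModularParametrizationData W (W.conductorNorm ℤ)) :=
  semistableModularDatum_of_CDT_theorem_7_1_2
    (BCDT.CDT_theorem_7_1_2_of_CDT721_722_723_auxiliaryCurve h721 h722 h723 hE)

/-- **`SemistableModularDatum` from the Modularity Theorem** (`exists_isNewformOf`,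
Breuil–Conrad–Diamond–Taylor 2001 Thm. A; only its semistable case is used), through the tree's
`nonempty_modularParametrizationData_of_isSemistable_of_exists_isNewformOf`.  CONDITIONAL on
`exists_isNewformOf`. [cite: BCDTJAMS2001, Thm. A] -/
theorem semistableModularDatum_of_exists_isNewformOf (hmod : exists_isNewformOf) :
    ∀ (W : WeierstrassCurve ℚ) [W.IsElliptic] [W.IsGloballyMinimal]
      [NeZero (W.conductorNorm ℤ)],
      W.IsSemistable ℤ → Nonempty (ModularParametrizationData W (W.conductorNorm ℤ)) :=
  fun W _ _ _ hW ↦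
    nonempty_modularParametrizationData_of_isSemistable_of_exists_isNewformOf hmod W hW

/-- **`SemistableModularDatum` is the semistable slice of the sibling route item
`ModularDatumExists`** (stmt-ABC-15126, definitionally the named fact
`nonempty_modularParametrizationData`, BCDT Thm. A in datum form): forget semistability (as in
`DegreePrimesPolyBounded.semistableModularDatum_of_modularDatumExists`, restated in this
namespace next to the other feeds). [cite: BCDTJAMS2001, Thm. A with (6) of p. 845] -/
theorem semistableModularDatum_of_modularDatumExists
    (hmod : Summit.ABC.ABC.Theses.IsogenyGlueCongruence.ModularDatumExists) :
    ∀ (W : WeierstrassCurve ℚ) [W.IsElliptic] [W.IsGloballyMinimal]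
      [NeZero (W.conductorNorm ℤ)],
      W.IsSemistable ℤ → Nonempty (ModularParametrizationData W (W.conductorNorm ℤ)) :=
  fun W _ _ _ _ ↦ hmod W

/-! ### Where the item sits: the modularity content of the K-line, the U-line and the A-line -/

/-- **Granted the Mazur–Kenku comparison, `DegreePrimeCongruence` (the modular input of the
K-line, stmt-ABC-14828) is EQUIVALENT to `SemistableModularDatum`.**  `MazurKenkuBound`
(stmt-ABC-15125) is definitionally `PastenShimura2024_minimalDegree_le_163_mul`, and the
tree's `degreePrimeCongruence_iff_semistableModularity` says that, granted it,
`DegreePrimeCongruence` is exactly semistable modularity; compose with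
`semistableModularDatum_iff_forall_isModular`. [cite: PastenShimura2024, §3 p. 13] -/
theorem degreePrimeCongruence_iff_semistableModularDatum
    (hMK : Summit.ABC.ABC.Theses.IsogenyGlueCongruence.MazurKenkuBound) :
    Summit.ABC.ABC.Theses.IsogenyGlueCongruence.DegreePrimeCongruence ↔
      ∀ (W : WeierstrassCurve ℚ) [W.IsElliptic] [W.IsGloballyMinimal]
        [NeZero (W.conductorNorm ℤ)],
        W.IsSemistable ℤ → Nonempty (ModularParametrizationData W (W.conductorNorm ℤ)) :=
  (degreePrimeCongruence_iff_semistableModularity hMK).trans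
    semistableModularDatum_iff_forall_isModular.symm

/-- **K-line glue over the two route items: `MazurKenkuBound → SemistableModularDatum →
DegreePrimeCongruence`** — the tree's `degreePrimeCongruenceOfMazurKenku_proof`
(`MazurKenkuBound → ModularDatumExists → DegreePrimeCongruence`) with its modularity
hypothesis weakened from all of BCDT Thm. A to the semistable slice; the `←` half of
`degreePrimeCongruence_iff_semistableModularDatum`. [cite: PastenShimura2024, §3 p. 13] -/
theorem degreePrimeCongruence_of_mazurKenkuBound_of_semistableModularDatum
    (hMK : Summit.ABC.ABC.Theses.IsogenyGlueCongruence.MazurKenkuBound)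
    (h : ∀ (W : WeierstrassCurve ℚ) [W.IsElliptic] [W.IsGloballyMinimal]
      [NeZero (W.conductorNorm ℤ)],
      W.IsSemistable ℤ → Nonempty (ModularParametrizationData W (W.conductorNorm ℤ))) :
    Summit.ABC.ABC.Theses.IsogenyGlueCongruence.DegreePrimeCongruence :=
  (degreePrimeCongruence_iff_semistableModularDatum hMK).mpr h

/-- **U-line height glue over the two route items: `MazurKenkuBound → SemistableModularDatum
→ SemistableHeightPolyBound`** (`h_F(E) ≤ c · N_E²` for semistable `E/ℚ`) — the tree's
`semistableHeightPolyBound_of_semistableModularDatum_of_mazurKenku` ((EqHDeg), Pasten's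
Thm. 5.5 — proved —, Shafarevich below the threshold; Murty–Pasten 2013 Thm. 1.1 in substance)
with its two hypotheses spelled as route items. [cite: MurtyPasten2013, Thm 1.1]
[cite: PastenShimura2024, §3 p. 13] -/
theorem semistableHeightPolyBound_of_mazurKenkuBound_of_semistableModularDatum
    (hMK : Summit.ABC.ABC.Theses.IsogenyGlueCongruence.MazurKenkuBound)
    (h : ∀ (W : WeierstrassCurve ℚ) [W.IsElliptic] [W.IsGloballyMinimal]
      [NeZero (W.conductorNorm ℤ)],
      W.IsSemistable ℤ → Nonempty (ModularParametrizationData W (W.conductorNorm ℤ))) :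
    Summit.ABC.ABC.Theses.IsogenyGlueCongruence.SemistableHeightPolyBound :=
  semistableHeightPolyBound_of_semistableModularDatum_of_mazurKenku h hMK

/-- **A-line valuation glue over the two route items: `MazurKenkuBound → SemistableModularDatum
→ (v_p(Δ_min(W)) ≤ C · N_W^κ for semistable globally minimal W and all p)`** — the reshaped
stub `DegreePrimesPolyBounded.stub_discValuationOfSemistableModularity` of crux A's line
`newpart_congruence_friability` (hypothesis (1) is the item verbatim), with Mazur–Kenku spelled
as the route item. [cite: PastenShimura2024, §3 p. 13, Thm. 7.2, Lemma 18.1] -/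
theorem discValuation_of_mazurKenkuBound_of_semistableModularDatum
    (hMK : Summit.ABC.ABC.Theses.IsogenyGlueCongruence.MazurKenkuBound)
    (h : ∀ (W : WeierstrassCurve ℚ) [W.IsElliptic] [W.IsGloballyMinimal]
      [NeZero (W.conductorNorm ℤ)],
      W.IsSemistable ℤ → Nonempty (ModularParametrizationData W (W.conductorNorm ℤ))) :
    ∃ κ C : ℝ, ∀ (W : WeierstrassCurve ℚ) [W.IsElliptic] [W.IsGloballyMinimal]
      [NeZero (W.conductorNorm ℤ)], W.IsSemistable ℤ → ∀ p : ℕ,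
        (((W.minimalDiscriminantNorm ℤ).factorization p : ℕ) : ℝ) ≤
          C * (W.conductorNorm ℤ : ℝ) ^ κ :=
  DegreePrimesPolyBounded.stub_discValuationOfSemistableModularity h hMK

/-- **`ModularJacobianMultipliers` (the modular instance of crux U, stmt-ABC-13920) implies
`SemistableModularDatum` outright** (its datum `D`).  Granted the modular Jacobian with
multiplicity one (`exists_modularJacobian_hom_generators`) the two are EQUIVALENT — that is the
tree's `modularJacobianMultipliers_iff_modularDatumExists_semistable`
(`IsogenyGlueCongruenceModularJacobianMultipliersOfModularDatumExists`), not restated here.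
[cite: AgasheRibetStein2012, §2.1] -/
theorem semistableModularDatum_of_modularJacobianMultipliers
    (h : Summit.ABC.ABC.Theses.IsogenyGlueCongruence.ModularJacobianMultipliers) :
    ∀ (W : WeierstrassCurve ℚ) [W.IsElliptic] [W.IsGloballyMinimal]
      [NeZero (W.conductorNorm ℤ)],
      W.IsSemistable ℤ → Nonempty (ModularParametrizationData W (W.conductorNorm ℤ)) :=
  fun W _ _ _ hW ↦ by
    obtain ⟨D, -⟩ := h W hW
    exact ⟨D⟩

/-- **`DegreePrimeCongruence` implies `SemistableModularDatum` outright** (its datum `D`).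
[cite: PastenShimura2024, §3 p. 13] -/
theorem semistableModularDatum_of_degreePrimeCongruence
    (h : Summit.ABC.ABC.Theses.IsogenyGlueCongruence.DegreePrimeCongruence) :
    ∀ (W : WeierstrassCurve ℚ) [W.IsElliptic] [W.IsGloballyMinimal]
      [NeZero (W.conductorNorm ℤ)],
      W.IsSemistable ℤ → Nonempty (ModularParametrizationData W (W.conductorNorm ℤ)) :=
  fun W _ _ _ hW ↦ by
    obtain ⟨D, -⟩ := h W hW
    exact ⟨D⟩

end Summit.ABC.ABC.Theorems

end
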